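import Summits.QuantumFields.BalabanUV.Beta.SymmetrisedDressingDress

/-!
# `BalabanUV.Beta.SymmetrisedDressingLinear` — linearity/exchange lemmas for the SYMMETRISED dressing and the chain-rule vertex of a
# symmetrised-dressed stencil family (β sub-cell, row D1 OWNER b2b-balaban-beta-an2, gen 26; K5c of the «JsB12Sym» wiring: decl-by-decl twin of
# `AxialDressingRootedBmLinear` with `Π_bm ↦ Π^{sym}_bm`)

HONEST FRAMING (cell charter, verbatim): «discharging BetaPertH makes Balaban's UV stability UNCONDITIONAL — a real
constructive-QFT result; it is NOT the continuum limit and NOT the Clay problem.»  DERIVED cell leaf; no statement of Bałaban's papers, no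
`[cite:]` tag, no `Prop` fact; instantiates no wall binder.  NOT D1, NOT `BetaPertH`; NOT continuum; NOT Clay.
HONEST DEPENDENCY: continuum YM on T⁴ ⇐ BetaPertH ∧ nine spine estimates (0/9 proved); BetaPertH ⇐ (D1) ∧ (D4) ∧ CAP+tail;
G-an2-4 gates asym, D1 and NE2/3/4.

## What is here (twins of `AxialDressingRootedBmLinear`): `coProjSymAt_tsum`, `legCo₁SymAt_tsum`/`legCo₂SymAt_tsum`, `dressKSymAt_tsum`,
`dressKSymAt_mul_left`, `dressKSymAt_finset_sum`, `dressKSymAt_wsum`, **`vertexOfK_dressKSymAt`**, the window `coProjSymW`, `colH_coDressKSymAt_eq`,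
`sum_tsum_mul_coProjSymAt`, `vertexOfK_coProjSymAtK`, **`vertexOfK_dressSymAt_S`** (`vertexOfK K N (dressSymAt hr J).S = vertexOfK (coDressKSymAt ρ N K) N J.S` dressed).
All declarations `[folklore]`; axioms standard.  Provenance: b2b-balaban β sub-cell, unit beta-an2 gen 26, 2026-08-21.
-/

open Finset
open scoped BigOperators
open Literature.MathematicalPhysics.QuantumFieldTheory
open Literature.MathematicalPhysics.QuantumFieldTheory.Balaban1983to89
open Literature.MathematicalPhysics.QuantumFieldTheory.Balaban1983to89.Beta
open B12Sec2to5 (l1 l1_nonneg)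
open ExpKernelCalculus (MKer Decays BiLoc comp tr bubble tadpole hessKer VertexFamily VertexFamily₂ shiftK l1_sub_symm)
open AffineAveraging (Form0 Form1 box toSite)
open AveragingContoursRooted (ctrOff ctrOff_mem_box)
open OneStepResolventKernel (Fib wsum LocStencil JetData)
open OneStepKernelFamily (KInvStep decays_KInvStep shiftK_KInvStep colH vertexOfK vertexFamily_vertexOfK' TstepOf TbalOf)
open Summit.QuantumFields.BalabanUV.Beta.TameKernelCalculus
open Summit.QuantumFields.BalabanUV.Beta.AxialDressingRooted
open Summit.QuantumFields.BalabanUV.Beta.SymmetrisedDressingMatrix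
open Summit.QuantumFields.BalabanUV.Beta.SymmetrisedDressingKernel
open Summit.QuantumFields.BalabanUV.Beta.SymmetrisedDressingLegs
open Summit.QuantumFields.BalabanUV.Beta.SymmetrisedDressingDress

namespace Summit.QuantumFields.BalabanUV.Beta.SymmetrisedDressingLinear

noncomputable section

variable {d : ℕ}

/-! ## §5 `Πᵀ_bm` through series and finite sums; the chain-rule vertex of dressed stencils -/

section LinearBm

variable (ρ : Fin (d + 1) → ℤ) (N : ℕ) {ι : Type*}

/-- [folklore] `Πᵀ_bm` passes through pointwise-summable series of one-forms. -/
theorem coProjSymAt_tsum {g : ι → Form1 (d + 1) ℝ} (hg : ∀ κ p, Summable fun i => g i κ p) (α : Fin (d + 1))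
    (q : Fin (d + 1) → ℤ) : coProjSymAt ρ N (fun κ p => ∑' i, g i κ p) α q = ∑' i, coProjSymAt ρ N (g i) α q := by
  simp only [coProjSymAt_apply]
  rw [Summable.tsum_finsetSum (fun v _ => summable_sum fun β _ => (hg β (q + v)).mul_left _)]
  refine Finset.sum_congr rfl fun v _ => ?_
  rw [Summable.tsum_finsetSum (fun β _ => (hg β (q + v)).mul_left _)]
  refine Finset.sum_congr rfl fun β _ => ?_
  rw [tsum_mul_left]

/-- [folklore] … and the family `i ↦ Πᵀ_bm g_i` is summable at every bond. -/
theorem summable_family_coProjSymAt {g : ι → Form1 (d + 1) ℝ} (hg : ∀ κ p, Summable fun i => g i κ p) (α : Fin (d + 1))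
    (q : Fin (d + 1) → ℤ) : Summable fun i => coProjSymAt ρ N (g i) α q := by
  simp only [coProjSymAt_apply]
  exact summable_sum fun v _ => summable_sum fun β _ => (hg β (q + v)).mul_left _

/-- [folklore] `Πᵀ_bm` on the first leg passes through pointwise-summable series of kernels. -/
theorem legCo₁SymAt_tsum {F : ι → MKer (d + 1) (Fib d)} (hF : ∀ x z a b, Summable fun i => F i x z a b)
    (x z : Fin (d + 1) → ℤ) (a b : Fib d) :
    legCo₁SymAt ρ N (fun x z a b => ∑' i, F i x z a b) x z a b = ∑' i, legCo₁SymAt ρ N (F i) x z a b := by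
  rcases a with α | m
  · rw [legCo₁SymAt_inl]
    exact coProjSymAt_tsum ρ N (g := fun i α' x' => F i x' z (Sum.inl α') b) (fun κ p => hF p z (Sum.inl κ) b) α x
  · rfl

/-- [folklore] … with a summable family of results. -/
theorem summable_family_legCo₁SymAt {F : ι → MKer (d + 1) (Fib d)} (hF : ∀ x z a b, Summable fun i => F i x z a b)
    (x z : Fin (d + 1) → ℤ) (a b : Fib d) : Summable fun i => legCo₁SymAt ρ N (F i) x z a b := by
  rcases a with α | m
  · exact summable_family_coProjSymAt ρ N (g := fun i α' x' => F i x' z (Sum.inl α') b) (fun κ p => hF p z (Sum.inl κ) b) α x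
  · exact hF x z (Sum.inr m) b

/-- [folklore] `Πᵀ_bm` on the second leg passes through pointwise-summable series of kernels. -/
theorem legCo₂SymAt_tsum {F : ι → MKer (d + 1) (Fib d)} (hF : ∀ x z a b, Summable fun i => F i x z a b)
    (x z : Fin (d + 1) → ℤ) (a b : Fib d) :
    legCo₂SymAt ρ N (fun x z a b => ∑' i, F i x z a b) x z a b = ∑' i, legCo₂SymAt ρ N (F i) x z a b := by
  rcases b with β | m
  · rw [legCo₂SymAt_inl]
    exact coProjSymAt_tsum ρ N (g := fun i β' z' => F i x z' a (Sum.inl β')) (fun κ p => hF x p a (Sum.inl κ)) β z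
  · rfl

/-- [folklore] … with a summable family of results. -/
theorem summable_family_legCo₂SymAt {F : ι → MKer (d + 1) (Fib d)} (hF : ∀ x z a b, Summable fun i => F i x z a b)
    (x z : Fin (d + 1) → ℤ) (a b : Fib d) : Summable fun i => legCo₂SymAt ρ N (F i) x z a b := by
  rcases b with β | m
  · exact summable_family_coProjSymAt ρ N (g := fun i β' z' => F i x z' a (Sum.inl β')) (fun κ p => hF x p a (Sum.inl κ)) β z
  · exact hF x z a (Sum.inr m)

/-- [folklore] **THE BLOCK-MEAN DRESSING PASSES THROUGH POINTWISE-SUMMABLE SERIES OF KERNELS.** -/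
theorem dressKSymAt_tsum {F : ι → MKer (d + 1) (Fib d)} (hF : ∀ x z a b, Summable fun i => F i x z a b)
    (x z : Fin (d + 1) → ℤ) (a b : Fib d) :
    dressKSymAt ρ N (fun x z a b => ∑' i, F i x z a b) x z a b = ∑' i, dressKSymAt ρ N (F i) x z a b := by
  simp only [dressKSymAt_eq_legs]
  have e : legCo₁SymAt ρ N (fun x z a b => ∑' i, F i x z a b) = fun x z a b => ∑' i, legCo₁SymAt ρ N (F i) x z a b :=
    funext fun x => funext fun z => funext fun a => funext fun b => legCo₁SymAt_tsum ρ N hF x z a b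
  rw [e, legCo₂SymAt_tsum ρ N (summable_family_legCo₁SymAt ρ N hF) x z a b]

/-- [folklore] The block-mean dressing is homogeneous. -/
theorem dressKSymAt_mul_left (c : ℝ) (K : MKer (d + 1) (Fib d)) (x z : Fin (d + 1) → ℤ) (a b : Fib d) :
    dressKSymAt ρ N (fun x z a b => c * K x z a b) x z a b = c * dressKSymAt ρ N K x z a b := by
  have e1 : ∀ (K : MKer (d + 1) (Fib d)) x z a b, legCo₁SymAt ρ N (fun x z a b => c * K x z a b) x z a b =
      c * legCo₁SymAt ρ N K x z a b := by
    intro K x z a b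
    rcases a with α | m
    · simp only [legCo₁SymAt_inl, coProjSymAt_apply, Finset.mul_sum]
      exact Finset.sum_congr rfl fun v _ => Finset.sum_congr rfl fun β _ => by ring
    · rfl
  have e2 : ∀ (K : MKer (d + 1) (Fib d)) x z a b, legCo₂SymAt ρ N (fun x z a b => c * K x z a b) x z a b =
      c * legCo₂SymAt ρ N K x z a b := by
    intro K x z a b
    rcases b with β | m
    · simp only [legCo₂SymAt_inl, coProjSymAt_apply, Finset.mul_sum]
      exact Finset.sum_congr rfl fun v _ => Finset.sum_congr rfl fun β _ => by ring
    · rfl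
  simp only [dressKSymAt_eq_legs]
  have e : legCo₁SymAt ρ N (fun x z a b => c * K x z a b) = fun x z a b => c * legCo₁SymAt ρ N K x z a b :=
    funext fun x => funext fun z => funext fun a => funext fun b => e1 K x z a b
  rw [e, e2]

/-- [folklore] The block-mean dressing is additive over finite sums. -/
theorem dressKSymAt_finset_sum (s : Finset ι) (K : ι → MKer (d + 1) (Fib d)) (x z : Fin (d + 1) → ℤ) (a b : Fib d) :
    dressKSymAt ρ N (fun x z a b => ∑ i ∈ s, K i x z a b) x z a b = ∑ i ∈ s, dressKSymAt ρ N (K i) x z a b := by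
  have e1 : ∀ (K : ι → MKer (d + 1) (Fib d)) x z a b, legCo₁SymAt ρ N (fun x z a b => ∑ i ∈ s, K i x z a b) x z a b =
      ∑ i ∈ s, legCo₁SymAt ρ N (K i) x z a b := by
    intro K x z a b
    rcases a with α | m
    · simp only [legCo₁SymAt_inl, coProjSymAt_apply, Finset.mul_sum]
      calc ∑ v ∈ cube (d + 1) N, ∑ β : Fin (d + 1), ∑ i ∈ s, pmSymBm ρ N β (x + v) α x * K i (x + v) z (Sum.inl β) b
          = ∑ v ∈ cube (d + 1) N, ∑ i ∈ s, ∑ β : Fin (d + 1), pmSymBm ρ N β (x + v) α x * K i (x + v) z (Sum.inl β) b :=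
            Finset.sum_congr rfl fun v _ => Finset.sum_comm
        _ = ∑ i ∈ s, ∑ v ∈ cube (d + 1) N, ∑ β : Fin (d + 1), pmSymBm ρ N β (x + v) α x * K i (x + v) z (Sum.inl β) b :=
            Finset.sum_comm
    · rfl
  have e2 : ∀ (K : ι → MKer (d + 1) (Fib d)) x z a b, legCo₂SymAt ρ N (fun x z a b => ∑ i ∈ s, K i x z a b) x z a b =
      ∑ i ∈ s, legCo₂SymAt ρ N (K i) x z a b := by
    intro K x z a b
    rcases b with β | m
    · simp only [legCo₂SymAt_inl, coProjSymAt_apply, Finset.mul_sum]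
      calc ∑ v ∈ cube (d + 1) N, ∑ β' : Fin (d + 1), ∑ i ∈ s, pmSymBm ρ N β' (z + v) β z * K i x (z + v) a (Sum.inl β')
          = ∑ v ∈ cube (d + 1) N, ∑ i ∈ s, ∑ β' : Fin (d + 1), pmSymBm ρ N β' (z + v) β z * K i x (z + v) a (Sum.inl β') :=
            Finset.sum_congr rfl fun v _ => Finset.sum_comm
        _ = ∑ i ∈ s, ∑ v ∈ cube (d + 1) N, ∑ β' : Fin (d + 1), pmSymBm ρ N β' (z + v) β z * K i x (z + v) a (Sum.inl β') :=
            Finset.sum_comm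
    · rfl
  simp only [dressKSymAt_eq_legs]
  have e : legCo₁SymAt ρ N (fun x z a b => ∑ i ∈ s, K i x z a b) = fun x z a b => ∑ i ∈ s, legCo₁SymAt ρ N (K i) x z a b :=
    funext fun x => funext fun z => funext fun a => funext fun b => e1 K x z a b
  rw [e, e2]

/-- [folklore] **THE BLOCK-MEAN DRESSING PASSES THROUGH WEIGHTED SUPERPOSITIONS** (`OneStepResolventKernel.wsum`). -/
theorem dressKSymAt_wsum {w : (Fin (d + 1) → ℤ) → ℝ} {T : (Fin (d + 1) → ℤ) → MKer (d + 1) (Fib d)}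
    (hs : ∀ x z a b, Summable fun u => w u * T u x z a b) :
    dressKSymAt ρ N (wsum w T) = wsum w (fun u => dressKSymAt ρ N (T u)) := by
  funext x z a b
  calc dressKSymAt ρ N (wsum w T) x z a b
      = ∑' u, dressKSymAt ρ N (fun x z a b => w u * T u x z a b) x z a b :=
        dressKSymAt_tsum ρ N (F := fun u x z a b => w u * T u x z a b) hs x z a b
    _ = ∑' u, w u * dressKSymAt ρ N (T u) x z a b := tsum_congr fun u => dressKSymAt_mul_left ρ N (w u) (T u) x z a b
    _ = wsum w (fun u => dressKSymAt ρ N (T u)) x z a b := rfl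

/-- [folklore] **THE CHAIN-RULE VERTEX THROUGH `K` OF BLOCK-MEAN-DRESSED STENCILS IS THE BLOCK-MEAN-DRESSED VERTEX:**
`vertexOfK K N (fun κ u ↦ dressKSymAt ρ N (T κ u)) μ y = dressKSymAt ρ N (vertexOfK K N T μ y)` (decaying `K`, local `T`). -/
theorem vertexOfK_dressKSymAt {K : MKer (d + 1) (Fib d)} {C δ : ℝ} (hK : Decays K C δ) (hδ : 0 ≤ δ)
    {T : Fin (d + 1) → (Fin (d + 1) → ℤ) → MKer (d + 1) (Fib d)} {Ct δt : ℝ} (hT : LocStencil T Ct δt) (hδt : 0 < δt)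
    (μ : Fin (d + 1)) (y : Fin (d + 1) → ℤ) :
    vertexOfK K N (fun κ u => dressKSymAt ρ N (T κ u)) μ y = dressKSymAt ρ N (vertexOfK K N T μ y) := by
  have h : ∀ κ' : Fin (d + 1), wsum (colH K N μ y κ') (fun u => dressKSymAt ρ N (T κ' u)) =
      dressKSymAt ρ N (wsum (colH K N μ y κ') (T κ')) :=
    fun κ' => (dressKSymAt_wsum ρ N (fun x z a b => AxialDressing.summable_colH_mul_stencil hK hδ hT hδt κ' μ y x z a b)).symm
  funext x z a b
  calc vertexOfK K N (fun κ u => dressKSymAt ρ N (T κ u)) μ y x z a b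
      = ∑ κ' : Fin (d + 1), wsum (colH K N μ y κ') (fun u => dressKSymAt ρ N (T κ' u)) x z a b := rfl
    _ = ∑ κ' : Fin (d + 1), dressKSymAt ρ N (wsum (colH K N μ y κ') (T κ')) x z a b :=
        Finset.sum_congr rfl fun κ' _ => by rw [h κ']
    _ = dressKSymAt ρ N (fun x z a b => ∑ κ' : Fin (d + 1), wsum (colH K N μ y κ') (T κ') x z a b) x z a b :=
        (dressKSymAt_finset_sum ρ N Finset.univ (fun κ' => wsum (colH K N μ y κ') (T κ')) x z a b).symm
    _ = dressKSymAt ρ N (vertexOfK K N T μ y) x z a b := rfl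

end LinearBm

/-! ## §6 The windowed adjunction and the vertex transfer -/

section AdjunctionBm

/-- [folklore] **THE WINDOWED `Π_bm` ON WEIGHT FAMILIES**: `coProjSymW ρ N A κ′ u′ := Σ_{v ∈ cube} Σ_κ pm ρ N κ′ u′ κ (u′ − v) · A κ (u′ − v)`
(the adjoint of the window operator `coProjSymAt ρ N`; for `A := colH K N μ y` it is the `ℋ`-column of the co-dressed kernel,
part 4 `colH_coDressKSymAt`). -/
def coProjSymW (ρ : Fin (d + 1) → ℤ) (N : ℕ) (A : Form1 (d + 1) ℝ) : Form1 (d + 1) ℝ :=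
  fun κ' u' => ∑ v ∈ cube (d + 1) N, ∑ κ : Fin (d + 1), pmSymBm ρ N κ' u' κ (u' - v) * A κ (u' - v)

/-- [folklore] `coProjSymW` unfolds. -/
theorem coProjSymW_apply (ρ : Fin (d + 1) → ℤ) (N : ℕ) (A : Form1 (d + 1) ℝ) (κ' : Fin (d + 1)) (u' : Fin (d + 1) → ℤ) :
    coProjSymW ρ N A κ' u' = ∑ v ∈ cube (d + 1) N, ∑ κ : Fin (d + 1), pmSymBm ρ N κ' u' κ (u' - v) * A κ (u' - v) := rfl

/-- [folklore] The `ℋ`-column of the co-dressed kernel is `coProjSymW` of the `ℋ`-column (part 4 `colH_coDressKSymAt`). -/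
theorem colH_coDressKSymAt_eq (ρ : Fin (d + 1) → ℤ) (N : ℕ) (K : MKer (d + 1) (Fib d)) (μ : Fin (d + 1))
    (y : Fin (d + 1) → ℤ) : colH (coDressKSymAt ρ N K) N μ y = coProjSymW ρ N (colH K N μ y) :=
  funext fun κ' => funext fun u' => colH_coDressKSymAt ρ N K μ y κ' u'

/-- [folklore] **THE WINDOWED ADJUNCTION** `Σ_κ Σ'_u A κ u · (Πᵀ_bm g) κ u = Σ_κ′ Σ'_u′ (coProjSymW ρ N A) κ′ u′ · g κ′ u′` for
summable weights `A` and bounded `g` (in-block root; finite sums out of the series, one lattice shift per window offset). -/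
theorem sum_tsum_mul_coProjSymAt {N : ℕ} (hN : 1 ≤ N) {r : Fin (d + 1) → ℕ} (hr : r ∈ box (d + 1) N)
    {A g : Form1 (d + 1) ℝ} (hA : ∀ κ, Summable (A κ)) {M : ℝ} (hg : ∀ κ u, |g κ u| ≤ M) :
    ∑ κ : Fin (d + 1), ∑' u, A κ u * coProjSymAt (toSite r) N g κ u =
      ∑ κ' : Fin (d + 1), ∑' u', coProjSymW (toSite r) N A κ' u' * g κ' u' := by
  set B : ℝ := (1 + 4 * (((d : ℝ) + 1) * N)) * |M| with hB
  -- termwise bound: `|A κ u · pm · g| ≤ |A κ u| · B`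
  have hterm : ∀ (κ κ' : Fin (d + 1)) (u w p : Fin (d + 1) → ℤ),
      |A κ u * (pmSymBm (toSite r) N κ' w κ p * g κ' w)| ≤ |A κ u| * B := by
    intro κ κ' u w p
    rw [abs_mul, abs_mul]
    refine mul_le_mul_of_nonneg_left ?_ (abs_nonneg _)
    exact mul_le_mul (abs_pmSymBm_le' hN hr κ' w κ p) ((hg κ' w).trans (le_abs_self M)) (abs_nonneg _)
      (by positivity)
  -- summability of the pieces, before and after the shift
  have hs1 : ∀ (κ κ' : Fin (d + 1)) (v : Fin (d + 1) → ℤ),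
      Summable fun u => A κ u * (pmSymBm (toSite r) N κ' (u + v) κ u * g κ' (u + v)) := fun κ κ' v =>
    Summable.of_norm_bounded ((hA κ).abs.mul_right B) fun u => by
      rw [Real.norm_eq_abs]; exact hterm κ κ' u (u + v) u
  have hs2 : ∀ (κ κ' : Fin (d + 1)) (v : Fin (d + 1) → ℤ),
      Summable fun u' => A κ (u' - v) * (pmSymBm (toSite r) N κ' u' κ (u' - v) * g κ' u') := fun κ κ' v =>
    Summable.of_norm_bounded (((Equiv.subRight v).summable_iff.2 (hA κ)).abs.mul_right B) fun u' => by
      rw [Real.norm_eq_abs]; exact hterm κ κ' (u' - v) u' (u' - v)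
  -- left side: finite sums out, then shift `u ↦ u′ − v`
  have hL : ∀ κ : Fin (d + 1), ∑' u, A κ u * coProjSymAt (toSite r) N g κ u =
      ∑ v ∈ cube (d + 1) N, ∑ κ' : Fin (d + 1), ∑' u', A κ (u' - v) * (pmSymBm (toSite r) N κ' u' κ (u' - v) * g κ' u') := by
    intro κ
    have e1 : (fun u => A κ u * coProjSymAt (toSite r) N g κ u) = fun u => ∑ v ∈ cube (d + 1) N, ∑ κ' : Fin (d + 1),
        A κ u * (pmSymBm (toSite r) N κ' (u + v) κ u * g κ' (u + v)) := by
      funext u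
      rw [coProjSymAt_apply, Finset.mul_sum]
      exact Finset.sum_congr rfl fun v _ => by rw [Finset.mul_sum]
    rw [e1, Summable.tsum_finsetSum (fun v _ => summable_sum fun κ' _ => hs1 κ κ' v)]
    refine Finset.sum_congr rfl fun v _ => ?_
    rw [Summable.tsum_finsetSum (fun κ' _ => hs1 κ κ' v)]
    refine Finset.sum_congr rfl fun κ' _ => ?_
    rw [← KKTFluctuationEnergy.tsum_shift_sub
      (fun u => A κ u * (pmSymBm (toSite r) N κ' (u + v) κ u * g κ' (u + v))) v]
    exact tsum_congr fun u' => by simp only [sub_add_cancel]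
  -- right side: finite sums out
  have hR : ∀ κ' : Fin (d + 1), ∑' u', coProjSymW (toSite r) N A κ' u' * g κ' u' =
      ∑ v ∈ cube (d + 1) N, ∑ κ : Fin (d + 1), ∑' u', A κ (u' - v) * (pmSymBm (toSite r) N κ' u' κ (u' - v) * g κ' u') := by
    intro κ'
    have e1 : (fun u' => coProjSymW (toSite r) N A κ' u' * g κ' u') = fun u' => ∑ v ∈ cube (d + 1) N, ∑ κ : Fin (d + 1),
        A κ (u' - v) * (pmSymBm (toSite r) N κ' u' κ (u' - v) * g κ' u') := by
      funext u'
      rw [coProjSymW_apply, Finset.sum_mul]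
      exact Finset.sum_congr rfl fun v _ => by
        rw [Finset.sum_mul]
        exact Finset.sum_congr rfl fun κ _ => by ring
    rw [e1, Summable.tsum_finsetSum (fun v _ => summable_sum fun κ _ => hs2 κ κ' v)]
    exact Finset.sum_congr rfl fun v _ => by rw [Summable.tsum_finsetSum (fun κ _ => hs2 κ κ' v)]
  simp_rw [hL, hR]
  -- both sides are now the same finite triple sum, in different orders
  set T : Fin (d + 1) → (Fin (d + 1) → ℤ) → Fin (d + 1) → ℝ := fun κ v κ' =>
    ∑' u', A κ (u' - v) * (pmSymBm (toSite r) N κ' u' κ (u' - v) * g κ' u') with hT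
  show ∑ κ : Fin (d + 1), ∑ v ∈ cube (d + 1) N, ∑ κ' : Fin (d + 1), T κ v κ' =
    ∑ κ' : Fin (d + 1), ∑ v ∈ cube (d + 1) N, ∑ κ : Fin (d + 1), T κ v κ'
  calc ∑ κ : Fin (d + 1), ∑ v ∈ cube (d + 1) N, ∑ κ' : Fin (d + 1), T κ v κ'
      = ∑ v ∈ cube (d + 1) N, ∑ κ : Fin (d + 1), ∑ κ' : Fin (d + 1), T κ v κ' := Finset.sum_comm
    _ = ∑ v ∈ cube (d + 1) N, ∑ κ' : Fin (d + 1), ∑ κ : Fin (d + 1), T κ v κ' :=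
        Finset.sum_congr rfl fun v _ => Finset.sum_comm
    _ = ∑ κ' : Fin (d + 1), ∑ v ∈ cube (d + 1) N, ∑ κ : Fin (d + 1), T κ v κ' := Finset.sum_comm

/-- [folklore] **THE BOND SLOT THROUGH `K`**: the chain-rule vertex of the `Πᵀ_bm`-dressed bond family is the superposition of
the UNDRESSED stencils with the `coProjSymW`-image of the `ℋ`-column as weights (decaying `K`, local `S`, in-block root). -/
theorem vertexOfK_coProjSymAtK {N : ℕ} (hN : 1 ≤ N) {r : Fin (d + 1) → ℕ} (hr : r ∈ box (d + 1) N)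
    {K : MKer (d + 1) (Fib d)} {C δ : ℝ} (hK : Decays K C δ) (hδK : 0 < δ)
    {S : Fin (d + 1) → (Fin (d + 1) → ℤ) → MKer (d + 1) (Fib d)} {Cs δs : ℝ} (hS : LocStencil S Cs δs) (hδs : 0 ≤ δs)
    (μ : Fin (d + 1)) (y x z : Fin (d + 1) → ℤ) (a b : Fib d) :
    vertexOfK K N (coProjSymAtK (toSite r) N S) μ y x z a b =
      ∑ κ' : Fin (d + 1), wsum (coProjSymW (toSite r) N (colH K N μ y) κ') (S κ') x z a b := by
  have hA : ∀ κ : Fin (d + 1), Summable (colH K N μ y κ) :=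
    fun κ => AxialDressing.summable_col_of_decays hK hδK ((N : ℤ) • y) (Sum.inl κ) (Sum.inr μ)
  have hg : ∀ (κ : Fin (d + 1)) (u : Fin (d + 1) → ℤ), |(fun κ u => S κ u x z a b) κ u| ≤ Cs := by
    intro κ u
    have h := hS κ u x z a b
    have hCs : 0 ≤ Cs := (hS κ u).nonneg (Sum.inl 0)
    have he : Real.exp (-δs * (l1 (x - u) + l1 (z - u))) ≤ 1 := by
      rw [Real.exp_le_one_iff]
      have := l1_nonneg (x - u)
      have := l1_nonneg (z - u)
      nlinarith
    calc |S κ u x z a b| ≤ Cs * Real.exp (-δs * (l1 (x - u) + l1 (z - u))) := h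
      _ ≤ Cs * 1 := mul_le_mul_of_nonneg_left he hCs
      _ = Cs := mul_one _
  have e1 : vertexOfK K N (coProjSymAtK (toSite r) N S) μ y x z a b =
      ∑ κ' : Fin (d + 1), ∑' u, colH K N μ y κ' u * coProjSymAt (toSite r) N (fun κ u => S κ u x z a b) κ' u := rfl
  rw [e1, sum_tsum_mul_coProjSymAt hN hr hA hg]
  rfl

/-- [folklore] **THE VERTEX TRANSFER**: for a decaying `K`, a jet datum `J` and an in-block root,
`vertexOfK K N (dressSymAt hr J).S μ y = dressKSymAt ρ N (vertexOfK (coDressKSymAt ρ N K) N J.S μ y)` — the chain-rule vertex through `K`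
of the block-mean-dressed stencils is the block-mean dressing of the vertex through the CO-DRESSED kernel of the undressed stencils. -/
theorem vertexOfK_dressSymAt_S {N : ℕ} [NeZero N] {r : Fin (d + 1) → ℕ} (hr : r ∈ box (d + 1) N)
    {K : MKer (d + 1) (Fib d)} {C δ : ℝ} (hK : Decays K C δ) (hδ : 0 < δ) (J : JetData d N) (μ : Fin (d + 1))
    (y : Fin (d + 1) → ℤ) :
    vertexOfK K N (dressSymAt hr J).S μ y = dressKSymAt (toSite r) N (vertexOfK (coDressKSymAt (toSite r) N K) N J.S μ y) := by
  have hN : 1 ≤ N := one_le_of_neZero N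
  have e1 : vertexOfK K N (dressSymAt hr J).S μ y =
      dressKSymAt (toSite r) N (vertexOfK K N (coProjSymAtK (toSite r) N J.S) μ y) :=
    vertexOfK_dressKSymAt (toSite r) N hK hδ.le (locStencil_coProjSymAtK hN hr J.loc J.δ_pos.le) J.δ_pos μ y
  rw [e1]
  congr 1
  funext x z a b
  rw [vertexOfK_coProjSymAtK hN hr hK hδ J.loc J.δ_pos.le, ← colH_coDressKSymAt_eq]
  rfl

end AdjunctionBm

end

end Summit.QuantumFields.BalabanUV.Beta.SymmetrisedDressingLinear
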